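import Literature.AnabelianGeometry.AbsoluteAnabelian.AbsTopIThm26iiiProofs
import Literature.AnabelianGeometry.AbsoluteAnabelian.AbsTopIDeltaOneFreeProlRankProofs
import Literature.AnabelianGeometry.AbsoluteAnabelian.AbsTopIThm26ivProofs
import Literature.AnabelianGeometry.AbsoluteAnabelian.GaloisSubextensionProofs
import Literature.AnabelianGeometry.AbsoluteAnabelian.ProfiniteRankProofs
import HarnessLib

/-!
# [AbsTopI] Thm 2.6 (v), general form: the group-theoretic core (`Θ ⊆ Π`, `ζ̃(Π) := ζ(Π/Θ)`)

S. Mochizuki, *Topics in Absolute Anabelian Geometry I: Generalities* (2012) [AbsTopI], Thm 2.6 (v),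
manuscript p. 22 (lit key `paper:url-11ac98ba15fc`): "If `θ²(Π) ≠ Primes`, then write `Θ ⊆ Π` for the
maximal almost pro-omissive topologically finitely generated closed normal subgroup of `Π`, whenever a
unique such maximal subgroup exists; if `θ²(Π) = Primes`, or there does not exist a unique such maximal
subgroup, set `Θ := {1} ⊆ Π`.  Then `ζ̃(Π) := ζ(Π/Θ) = [k : ℚ_p]`", and its PROOF p. 24 l. 4–22 (the
three cases `θ²(Π) = Primes` / `|θ¹(Π)| ≥ 2` / `θ¹(Π) = {p}`, using (ii), (iii), (iv)).

PROOF-ONLY companion (no definitions, no named facts) of abc-iut-L4-t4's statements file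
`AbsTopIThm26iii.lean` (`thetaSubgroup`, `zetaTildeInv`, `IsMaximalAPONormal`, `thetaSet`).  This file is
the ABSTRACT core used by `AbsTopIThm26vFullClosers.lean`: for a continuous surjection `a : Λ ↠ Γ` of
topological groups (`Λ` compact — print's `Π`, which is a reserved token in Lean) with `Γ` "`G_k`-like"
— every almost pro-omissive topologically finitely generated closed normal subgroup of `Γ` is trivial
(elasticity + no almost pro-omissive open subgroup) and `δ¹_p(Γ) = 1 + D`, `δ¹_l(Γ) = 1` (`l ≠ p`) —,
`Ker a` topologically finitely generated and pro-`Σ`, the rank identity of (ii) and (iii) for `Λ`,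
`zetaTildeInv_eq_of_inputs` proves `ζ̃(Λ) = D` along the printed case analysis.  Ingredients:
`zetaInv_eq_of_freeProlRank_eq` (`ζ` from the ranks), the two branches of `Θ`
(`thetaSubgroup_eq_bot_of_not`, `thetaSubgroup_eq_of_isMaximalAPONormal`), step one of (iv)
(`le_ker_of_isAlmostProOmissive`), and `freeProlRank_le_one_of_not_mem_thetaSet_one`
(`l ∉ θ¹ ⇒ δ¹_l ≤ 1`, via `deltaInv_one_eq_freeProlRank`).

HONEST FRAMING: refereed, undisputed profinite group theory; abc-iut cell, block C seat abc-iut-w6-d034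
(L4-lead RULING #7k «THM26V-FULL-CLOSE»); nothing here bears on [IUTchIII] Cor. 3.12.
-/

noncomputable section

open Topology

namespace Literature.AnabelianGeometry.AbsoluteAnabelian

universe u v

/-! ### `ζ` from the free pro-`l` ranks -/

section ZetaRanks

variable {X : Type u} [Group X] [TopologicalSpace X]

/-- If the free pro-`l` ranks of `X` are `c + D` at `l = p` and `c` at every other prime, then
`ζ(X) = sup_{p₁, p₂} (δ¹_{p₁}(X) − δ¹_{p₂}(X)) = D` (the shape of `ζ(G_k) = ([k : ℚ_p] + 1) − 1`,
[AbsTopI] Thm 2.6 (ii)/(v)). [cite: MochizukiAbsTopI2012, Thm 2.6 (v) proof p.24] -/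
theorem zetaInv_eq_of_freeProlRank_eq (p : ℕ) [hp : Fact p.Prime] (c D : ℕ)
    (hpr : freeProlRank X p = ((c + D : ℕ) : ℕ∞))
    (hl : ∀ (l : ℕ) [Fact l.Prime], l ≠ p → freeProlRank X l = (c : ℕ∞)) :
    zetaInv X = (D : ℕ∞) := by
  -- every rank is `c` or `c + D`
  have hval : ∀ (q : Nat.Primes), @freeProlRank X _ _ q.1 ⟨q.2⟩ = (c : ℕ∞) ∨
      @freeProlRank X _ _ q.1 ⟨q.2⟩ = ((c + D : ℕ) : ℕ∞) := by
    intro q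
    by_cases hq : (q.1 : ℕ) = p
    · right
      have : @freeProlRank X _ _ q.1 ⟨q.2⟩ = @freeProlRank X _ _ p hp := by subst hq; rfl
      rw [this, hpr]
    · exact Or.inl (@hl q.1 ⟨q.2⟩ hq)
  unfold zetaInv
  refine le_antisymm ?_ ?_
  · refine iSup_le fun q₁ => iSup_le fun q₂ => ?_
    rcases hval q₁ with h₁ | h₁ <;> rcases hval q₂ with h₂ | h₂ <;> rw [h₁, h₂] <;> norm_cast <;>
      simp
  · -- a prime `p' ≠ p`
    obtain ⟨p', hp', hne⟩ : ∃ p' : ℕ, p'.Prime ∧ p' ≠ p := by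
      by_cases h2 : p = 2
      · exact ⟨3, Nat.prime_three, by omega⟩
      · exact ⟨2, Nat.prime_two, fun h => h2 h.symm⟩
    refine le_iSup₂_of_le ⟨p, hp.out⟩ ⟨p', hp'⟩ ?_
    have h₁ : @freeProlRank X _ _ p ⟨hp.out⟩ = ((c + D : ℕ) : ℕ∞) := hpr
    rw [h₁, @hl p' ⟨hp'⟩ hne]
    norm_cast
    simp

/-- If two topological groups have the same free pro-`l` rank at every prime, they have the same
`ζ`. [cite: MochizukiAbsTopI2012, Thm 2.6 p.21] -/
theorem zetaInv_congr_of_freeProlRank_eq {Y : Type v} [Group Y] [TopologicalSpace Y]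
    (h : ∀ (l : ℕ) [Fact l.Prime], freeProlRank X l = freeProlRank Y l) :
    zetaInv X = zetaInv Y := by
  unfold zetaInv
  refine iSup_congr fun q₁ => iSup_congr fun q₂ => ?_
  rw [@h q₁.1 ⟨q₁.2⟩, @h q₂.1 ⟨q₂.2⟩]

end ZetaRanks

/-! ### Bicontinuous isomorphisms used for transport -/

section Equivs

variable {G : Type u} [Group G] [TopologicalSpace G]

/-- A subgroup equal to `⊤` is bicontinuously isomorphic to the ambient group (transport plumbing for
the invariants `δ¹_l`, `θʲ`, `ζ̃` of [AbsTopI] Thm 2.6 between `Π` and its open subgroup `Π ⊆ Π`).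
[cite: MochizukiAbsTopI2012, Thm 2.6 p.21] -/
theorem nonempty_continuousMulEquiv_of_eq_top (K : Subgroup G) (h : K = ⊤) : Nonempty (K ≃ₜ* G) :=
  ⟨{ toFun := fun x => (x : G)
     invFun := fun g => ⟨g, h ▸ Subgroup.mem_top g⟩
     left_inv := fun _ => rfl
     right_inv := fun _ => rfl
     map_mul' := fun _ _ => rfl
     continuous_toFun := continuous_subtype_val
     continuous_invFun := Continuous.subtype_mk continuous_id _ }⟩

variable [IsTopologicalGroup G]

/-- The quotient by a normal subgroup equal to `{1}` is bicontinuously isomorphic to the group.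
[folklore] -/
private theorem nonempty_continuousMulEquiv_quotient_of_eq_bot' (N : Subgroup G) [N.Normal] (hN : N = ⊥) :
    Nonempty (G ⧸ N ≃ₜ* G) := by
  subst hN
  refine ⟨{ QuotientGroup.quotientBot with
    continuous_toFun := ?_
    continuous_invFun := ?_ }⟩
  · change Continuous (QuotientGroup.quotientBot : G ⧸ (⊥ : Subgroup G) → G)
    rw [← QuotientGroup.isOpenQuotientMap_mk.continuous_comp_iff]
    have : (QuotientGroup.quotientBot : G ⧸ (⊥ : Subgroup G) → G) ∘ QuotientGroup.mk = id :=
      funext fun _ => rfl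
    rw [this]
    exact continuous_id
  · change Continuous (fun g : G => (QuotientGroup.quotientBot.symm g : G ⧸ (⊥ : Subgroup G)))
    exact QuotientGroup.continuous_mk

/-- For a continuous surjection `a : G ↠ Γ` from a compact group onto a Hausdorff group, the
quotient of `G` by a normal subgroup EQUAL to `Ker a` is bicontinuously isomorphic to `Γ`.
[folklore] -/
private theorem nonempty_continuousMulEquiv_quotient_of_eq_ker [CompactSpace G] {Γ : Type v} [Group Γ]
    [TopologicalSpace Γ] [IsTopologicalGroup Γ] [T2Space Γ] (a : G →ₜ* Γ)
    (ha : Function.Surjective a) (N : Subgroup G) [N.Normal] (hN : N = a.toMonoidHom.ker) :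
    Nonempty (G ⧸ N ≃ₜ* Γ) := by
  subst hN
  let e₀ : G ⧸ a.toMonoidHom.ker ≃* Γ := QuotientGroup.quotientKerEquivOfSurjective a.toMonoidHom ha
  have hc : Continuous e₀ := by
    rw [← QuotientGroup.isOpenQuotientMap_mk.continuous_comp_iff]
    have : (e₀ : G ⧸ a.toMonoidHom.ker → Γ) ∘ QuotientGroup.mk = a := funext fun _ => rfl
    rw [this]
    exact a.continuous
  let h : G ⧸ a.toMonoidHom.ker ≃ₜ Γ := hc.homeoOfEquivCompactToT2 (f := e₀.toEquiv)
  exact ⟨{ e₀ with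
    continuous_toFun := h.continuous
    continuous_invFun := h.symm.continuous }⟩

end Equivs

/-! ### `Θ`: the two branches of its definition -/

section Theta

variable (G : Type u) [Group G] [TopologicalSpace G] [IsTopologicalGroup G]

/-- "if `θ²(Π) = Primes`, or there does not exist a unique such maximal subgroup, set `Θ := {1}`".
[cite: MochizukiAbsTopI2012, Thm 2.6 (v) p.22] -/
theorem thetaSubgroup_eq_bot_of_not
    (h : ¬ (thetaSet G 2 ≠ {l | l.Prime} ∧ ∃! N : Subgroup G, IsMaximalAPONormal G N)) :
    thetaSubgroup G = ⊥ := by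
  unfold thetaSubgroup
  rw [dif_neg h]

/-- "write `Θ ⊆ Π` for the maximal almost pro-omissive topologically finitely generated closed
normal subgroup of `Π`, whenever a unique such maximal subgroup exists": if `N` is such a maximal
subgroup (and `θ²(Π) ≠ Primes`), then `Θ = N`. [cite: MochizukiAbsTopI2012, Thm 2.6 (v) p.22] -/
theorem thetaSubgroup_eq_of_isMaximalAPONormal (h2 : thetaSet G 2 ≠ {l | l.Prime})
    (hu : ∃! N : Subgroup G, IsMaximalAPONormal G N) {N : Subgroup G}
    (hN : IsMaximalAPONormal G N) : thetaSubgroup G = N :=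
  hu.unique (isMaximalAPONormal_thetaSubgroup G h2 hu) hN

/-- In the branch `Θ = {1}`: `ζ̃(Π) = ζ(Π/{1}) = ζ(Π)`. [cite: MochizukiAbsTopI2012, Thm 2.6 (v) p.22] -/
theorem zetaTildeInv_eq_zetaInv_of_thetaSubgroup_eq_bot (h : thetaSubgroup G = ⊥) :
    zetaTildeInv G = zetaInv G := by
  have hb : (thetaSubgroup G).normalCore = ⊥ := by rw [normalCore_thetaSubgroup, h]
  obtain ⟨e⟩ := nonempty_continuousMulEquiv_quotient_of_eq_bot' (thetaSubgroup G).normalCore hb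
  unfold zetaTildeInv
  exact zetaInv_eq_of_continuousMulEquiv e

end Theta

/-! ### Small combinatorial helpers -/

section Helpers

/-- If a set of naturals does not have at least two elements, some prime different from `p`
lies outside it (two of `2, 3, 5` differ from `p`). [folklore] -/
private theorem exists_prime_ne_not_mem (p : ℕ) {s : Set ℕ} (hs : ¬ 2 ≤ s.encard) :
    ∃ l, l.Prime ∧ l ≠ p ∧ l ∉ s := by
  by_contra hcon
  push Not at hcon
  apply hs
  obtain ⟨l₁, l₂, h₁, h₂, hne, h₁p, h₂p⟩ :
      ∃ l₁ l₂ : ℕ, l₁.Prime ∧ l₂.Prime ∧ l₁ ≠ l₂ ∧ l₁ ≠ p ∧ l₂ ≠ p := by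
    by_cases hp2 : p = 2
    · exact ⟨3, 5, Nat.prime_three, Nat.prime_five, by omega, by omega, by omega⟩
    by_cases hp3 : p = 3
    · exact ⟨2, 5, Nat.prime_two, Nat.prime_five, by omega, by omega, by omega⟩
    · exact ⟨2, 3, Nat.prime_two, Nat.prime_three, by omega, by omega, by omega⟩
  have hsub : ({l₁, l₂} : Set ℕ) ⊆ s := by
    intro x hx
    rcases hx with rfl | rfl
    · exact hcon _ h₁ h₁p
    · exact hcon _ h₂ h₂p
  calc (2 : ℕ∞) = ({l₁, l₂} : Set ℕ).encard := (Set.encard_pair hne).symm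
    _ ≤ s.encard := Set.encard_le_encard hsub

/-- In `ℕ∞`: `1 + m ≤ 1` forces the natural number `m` to vanish. [folklore] -/
private theorem nat_eq_zero_of_one_add_le {m : ℕ} (h : (1 : ℕ∞) + m ≤ 1) : m = 0 := by
  have h' : ((1 + m : ℕ) : ℕ∞) ≤ ((1 : ℕ) : ℕ∞) := by simpa using h
  have := Nat.cast_le.mp h'
  omega

end Helpers

/-! ### The group-theoretic core of the proof of [AbsTopI] Thm 2.6 (v) (p. 24) -/

section Core

variable {Λ : Type u} [Group Λ] [TopologicalSpace Λ] [IsTopologicalGroup Λ]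
variable {Γ : Type v} [Group Γ] [TopologicalSpace Γ] [IsTopologicalGroup Γ] [T2Space Γ]

/-- `l ∉ θ¹(Λ)` bounds the free pro-`l` rank of the compact group `Λ` by `1`: `ε¹_l(Λ) < 2` and
`δ¹_l(Λ) = dim H¹(Λ, ℚ_l) ≤ ε¹_l(Λ)` (`deltaInv_one_eq_freeProlRank`).
[cite: MochizukiAbsTopI2012, Thm 2.6 p.21] -/
theorem freeProlRank_le_one_of_not_mem_thetaSet_one [CompactSpace Λ] {l : ℕ} [hl : Fact l.Prime]
    (h : l ∉ thetaSet Λ 1) : freeProlRank Λ l ≤ 1 := by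
  have hε : ¬ (2 : ℕ∞) ≤ epsilonInv Λ 1 l := by
    intro h2
    exact h ⟨hl.out, by simpa using h2⟩
  have htop : IsOpen ((⊤ : Subgroup Λ) : Set Λ) := by rw [Subgroup.coe_top]; exact isOpen_univ
  haveI : CompactSpace (⊤ : Subgroup Λ) :=
    isCompact_iff_compactSpace.mp (by rw [Subgroup.coe_top]; exact isCompact_univ)
  obtain ⟨e⟩ := nonempty_continuousMulEquiv_of_eq_top (⊤ : Subgroup Λ) rfl
  have hδ : freeProlRank Λ l ≤ epsilonInv Λ 1 l := by
    rw [← freeProlRank_eq_of_continuousMulEquiv e l, ← deltaInv_one_eq_freeProlRank l]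
    exact le_iSup₂_of_le (⊤ : Subgroup Λ) htop le_rfl
  have hlt : freeProlRank Λ l < 1 + 1 := by
    rw [one_add_one_eq_two]
    exact lt_of_le_of_lt hδ (not_le.mp hε)
  exact Order.le_of_lt_add_one hlt

/-- Step one of the proof of [AbsTopI] Thm 2.6 (iv)/(v) (p. 24 l. 1–3), abstract form: along a
continuous surjection `a : Λ ↠ Γ` onto a group `Γ` in which every almost pro-omissive topologically
finitely generated closed normal subgroup is trivial (the shape of `G_k`: elastic with no almost
pro-omissive open subgroup), every almost pro-omissive topologically finitely generated closed normal
subgroup `N ⊆ Λ` of the compact group `Λ` lies in `Ker a` (its image in `Γ` is again such a subgroup).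
[cite: MochizukiAbsTopI2012, Thm 2.6 (iv) p.22] -/
theorem le_ker_of_isAlmostProOmissive [CompactSpace Λ] (a : Λ →ₜ* Γ) (ha : Function.Surjective a)
    (hΓ : ∀ M : Subgroup Γ, M.Normal → IsClosed (M : Set Γ) → IsTopologicallyFinitelyGenerated M →
      IsAlmostProOmissive M → M = ⊥)
    (N : Subgroup Λ) (hN : N.Normal) (hNc : IsClosed (N : Set Λ))
    (hNfg : IsTopologicallyFinitelyGenerated N) (hNapo : IsAlmostProOmissive N) :
    N ≤ a.toMonoidHom.ker := by
  set M : Subgroup Γ := N.map a.toMonoidHom with hMdef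
  let φ : N →ₜ* M :=
    ⟨a.toMonoidHom.subgroupMap N, Continuous.subtype_mk (a.continuous.comp continuous_subtype_val) _⟩
  have hφ : Function.Surjective φ := a.toMonoidHom.subgroupMap_surjective N
  have hMn : M.Normal := hN.map a.toMonoidHom ha
  have hMc : IsClosed (M : Set Γ) := by
    rw [hMdef, Subgroup.coe_map]
    exact (hNc.isCompact.image a.continuous).isClosed
  have hMfg : IsTopologicallyFinitelyGenerated M := hNfg.of_surjective φ hφ
  haveI : CompactSpace N := isCompact_iff_compactSpace.mp hNc.isCompact
  have hMapo : IsAlmostProOmissive M := hNapo.of_surjective φ hφ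
  have hM : M = ⊥ := hΓ M hMn hMc hMfg hMapo
  intro x hx
  rw [MonoidHom.mem_ker]
  have hxM : a.toMonoidHom x ∈ M := ⟨x, hx, rfl⟩
  rw [hM] at hxM
  exact Subgroup.mem_bot.mp hxM

/-- **The core of [AbsTopI] Thm 2.6 (v), p. 24 l. 4–22, for an abstract compact `Λ ↠ Γ`.**  Let
`a : Λ ↠ Γ` be a continuous surjection of topological groups, `Λ` compact Hausdorff, `Γ` Hausdorff
and "`G_k`-like": every almost pro-omissive topologically finitely generated closed normal subgroup
of `Γ` is trivial, and `δ¹_p(Γ) = 1 + D`, `δ¹_l(Γ) = 1` for `l ≠ p` (local class field theory,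
`D = [k : ℚ_p]`).  Let `Δ := Ker a` be topologically finitely generated and pro-`Σ` (`Σ ⊆ Primes`),
assume the rank identity of (ii) "`δ¹_l(Λ) = δ¹_l(Γ) + m` for `l ∈ Σ`" and (iii) "`θ²(Λ) ⊆ Σ`; if
`|θ¹(Λ)| ≥ 2` then `θ²(Λ) = Σ`".  THEN `ζ̃(Λ) = ζ(Λ/Θ) = D`.  Proof as printed: if some prime lies
outside `Σ`, `Δ` is the unique maximal almost pro-omissive tfg closed normal subgroup (step one +
`Δ` pro-`Σ`) and `θ²(Λ) ≠ Primes`, so `Θ = Δ`, `Λ/Θ ≅ Γ`; if all primes lie in `Σ`, either `Θ = {1}`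
and `ζ(Λ) = ζ(Γ)` by the rank identity, or `Θ ⊆ Δ` with `θ²(Λ) ≠ Primes`, whence `|θ¹(Λ)| ≤ 1`,
some `l ≠ p` has `δ¹_l(Λ) ≤ 1 = δ¹_l(Γ)`, `m = 0`, and `δ¹(Γ) ≤ δ¹(Λ/Θ) ≤ δ¹(Λ) = δ¹(Γ)`.
[cite: MochizukiAbsTopI2012, Thm 2.6 (v) proof p.24] -/
theorem zetaTildeInv_eq_of_inputs [CompactSpace Λ] [T2Space Λ] (a : Λ →ₜ* Γ)
    (ha : Function.Surjective a)
    (hΓ : ∀ M : Subgroup Γ, M.Normal → IsClosed (M : Set Γ) → IsTopologicallyFinitelyGenerated M →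
      IsAlmostProOmissive M → M = ⊥)
    (p : ℕ) [hp : Fact p.Prime] (D : ℕ) (hΓp : freeProlRank Γ p = ((1 + D : ℕ) : ℕ∞))
    (hΓl : ∀ (l : ℕ) [Fact l.Prime], l ≠ p → freeProlRank Γ l = 1)
    {S : Set ℕ} (hS : S ⊆ {q | q.Prime})
    (hΔfg : IsTopologicallyFinitelyGenerated a.toMonoidHom.ker)
    (hΔS : IsProSet a.toMonoidHom.ker S)
    (hQ : ∃ m : ℕ, ∀ (l : ℕ) [Fact l.Prime], l ∈ S → freeProlRank Λ l = freeProlRank Γ l + m)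
    (hiii : thetaSet Λ 2 ⊆ {l ∈ S | l.Prime} ∧
      (2 ≤ (thetaSet Λ 1).encard → thetaSet Λ 2 = {l ∈ S | l.Prime})) :
    zetaTildeInv Λ = (D : ℕ∞) := by
  set Δ : Subgroup Λ := a.toMonoidHom.ker with hΔdef
  have hΔc : IsClosed (Δ : Set Λ) := by
    rw [hΔdef, MonoidHom.coe_ker]
    exact isClosed_singleton.preimage a.continuous
  -- step one: almost pro-omissive tfg closed normal subgroups lie in `Δ`
  have step1 : ∀ N : Subgroup Λ, N.Normal → IsClosed (N : Set Λ) →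
      IsTopologicallyFinitelyGenerated N → IsAlmostProOmissive N → N ≤ Δ :=
    fun N hN hNc hNfg hNapo => le_ker_of_isAlmostProOmissive a ha hΓ N hN hNc hNfg hNapo
  -- `ζ(Γ) = D`
  have hΓl' : ∀ (l : ℕ) [Fact l.Prime], l ≠ p → freeProlRank Γ l = ((1 : ℕ) : ℕ∞) := by
    intro l _ hl; rw [hΓl l hl, Nat.cast_one]
  have ζΓ : zetaInv Γ = (D : ℕ∞) := zetaInv_eq_of_freeProlRank_eq p 1 D hΓp hΓl'
  by_cases hall : ∀ q : ℕ, q.Prime → q ∈ S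
  · -- every prime lies in `Σ`
    have hSP : {l ∈ S | l.Prime} = {l | l.Prime} := by
      ext l
      simp only [Set.mem_setOf_eq, and_iff_right_iff_imp]
      exact hall l
    obtain ⟨m, hm⟩ := hQ
    by_cases hcond : (thetaSet Λ 2 ≠ {l | l.Prime} ∧ ∃! N : Subgroup Λ, IsMaximalAPONormal Λ N)
    · -- `Θ` is the maximal subgroup, `Θ ⊆ Δ`
      have hΘ := isMaximalAPONormal_thetaSubgroup Λ hcond.1 hcond.2
      obtain ⟨⟨hΘn, hΘc, hΘfg, hΘapo⟩, -⟩ := hΘ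
      have hΘle : thetaSubgroup Λ ≤ Δ := step1 _ hΘn hΘc hΘfg hΘapo
      -- `θ²(Λ) ≠ Primes = Σ` forces `|θ¹(Λ)| ≤ 1`
      have hnot2 : ¬ 2 ≤ (thetaSet Λ 1).encard := fun h2 => hcond.1 (by rw [hiii.2 h2, hSP])
      obtain ⟨l, hlP, hlp, hl⟩ := exists_prime_ne_not_mem p hnot2
      haveI : Fact l.Prime := ⟨hlP⟩
      have hrl : freeProlRank Λ l ≤ 1 := freeProlRank_le_one_of_not_mem_thetaSet_one hl
      have hm0 : m = 0 := by
        have h1 := hm l (hall l hlP)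
        rw [hΓl l hlp] at h1
        rw [h1] at hrl
        exact nat_eq_zero_of_one_add_le hrl
      have hranks : ∀ (q : ℕ) [Fact q.Prime], freeProlRank Λ q = freeProlRank Γ q := by
        intro q hq
        rw [hm q (hall q hq.out), hm0, Nat.cast_zero, add_zero]
      -- squeeze `δ¹(Γ) ≤ δ¹(Λ/Θ) ≤ δ¹(Λ)`
      set M : Subgroup Λ := (thetaSubgroup Λ).normalCore with hMdef
      have hMle : M ≤ a.toMonoidHom.ker := (Subgroup.normalCore_le _).trans hΘle
      let π₁ : Λ →ₜ* Λ ⧸ M := ⟨QuotientGroup.mk' M, QuotientGroup.continuous_mk⟩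
      have hπ₁ : Function.Surjective π₁ := QuotientGroup.mk'_surjective M
      have hc₂ : Continuous (QuotientGroup.lift M a.toMonoidHom hMle) := by
        rw [← QuotientGroup.isOpenQuotientMap_mk.continuous_comp_iff]
        have : (QuotientGroup.lift M a.toMonoidHom hMle : Λ ⧸ M → Γ) ∘ QuotientGroup.mk = a :=
          funext fun _ => rfl
        rw [this]
        exact a.continuous
      let π₂ : Λ ⧸ M →ₜ* Γ := ⟨QuotientGroup.lift M a.toMonoidHom hMle, hc₂⟩
      have hπ₂ : Function.Surjective π₂ := by
        intro y
        obtain ⟨x, rfl⟩ := ha y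
        exact ⟨QuotientGroup.mk x, rfl⟩
      have hq : ∀ (q : ℕ) [Fact q.Prime], freeProlRank (Λ ⧸ M) q = freeProlRank Γ q := by
        intro q _
        refine le_antisymm ?_ (freeProlRank_le_of_surjective π₂ hπ₂ q)
        rw [← hranks q]
        exact freeProlRank_le_of_surjective π₁ hπ₁ q
      show zetaInv (Λ ⧸ M) = _
      rw [zetaInv_congr_of_freeProlRank_eq hq, ζΓ]
    · -- `Θ = {1}`: `ζ̃(Λ) = ζ(Λ)`, computed from the rank identity
      rw [zetaTildeInv_eq_zetaInv_of_thetaSubgroup_eq_bot Λ (thetaSubgroup_eq_bot_of_not Λ hcond)]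
      refine zetaInv_eq_of_freeProlRank_eq p (1 + m) D ?_ ?_
      · rw [hm p (hall p hp.out), hΓp]
        push_cast
        ring
      · intro l _ hlp
        rw [hm l (hall l Fact.out), hΓl l hlp]
        push_cast
        rfl
  · -- some prime `q ∉ Σ`: `Δ` is THE maximal subgroup, `Θ = Δ`, `Λ/Θ ≅ Γ`
    push Not at hall
    obtain ⟨q, hq, hqS⟩ := hall
    have hΔapo : IsAlmostProOmissive Δ := by
      have htop : IsOpen (((⊤ : Subgroup Δ)) : Set Δ) := by rw [Subgroup.coe_top]; exact isOpen_univ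
      refine ⟨⟨q, ⊤, hq, htop, ?_⟩⟩
      have h1 : IsProSet Δ {r | r.Prime ∧ r ≠ q} :=
        hΔS.mono fun r hr => ⟨hS hr, fun h => hqS (h ▸ hr)⟩
      let ι : Δ →ₜ* (⊤ : Subgroup Δ) := ⟨(Subgroup.topEquiv : (⊤ : Subgroup Δ) ≃* Δ).symm.toMonoidHom,
        Continuous.subtype_mk continuous_id _⟩
      exact h1.of_surjective ι (Subgroup.topEquiv (G := Δ)).symm.surjective
    have hΔmax : IsMaximalAPONormal Λ Δ :=
      ⟨⟨inferInstance, hΔc, hΔfg, hΔapo⟩,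
        fun N' hn hc hfg hapo hle => le_antisymm (step1 N' hn hc hfg hapo) hle⟩
    have huniq : ∃! N : Subgroup Λ, IsMaximalAPONormal Λ N := by
      refine ⟨Δ, hΔmax, fun N hN => ?_⟩
      obtain ⟨⟨hn, hc, hfg, hapo⟩, hmax⟩ := hN
      exact (hmax Δ inferInstance hΔc hΔfg hΔapo (step1 N hn hc hfg hapo)).symm
    have h2 : thetaSet Λ 2 ≠ {l | l.Prime} := by
      intro h
      have hq2 : q ∈ thetaSet Λ 2 := by rw [h]; exact hq
      exact hqS (hiii.1 hq2).1
    have hΘ : thetaSubgroup Λ = Δ := thetaSubgroup_eq_of_isMaximalAPONormal Λ h2 huniq hΔmax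
    have hM : (thetaSubgroup Λ).normalCore = a.toMonoidHom.ker := by
      rw [normalCore_thetaSubgroup, hΘ]
    obtain ⟨e⟩ := nonempty_continuousMulEquiv_quotient_of_eq_ker a ha _ hM
    unfold zetaTildeInv
    rw [zetaInv_congr_of_freeProlRank_eq (fun q _ => freeProlRank_eq_of_continuousMulEquiv e q), ζΓ]

end Core

end Literature.AnabelianGeometry.AbsoluteAnabelian

end
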